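import Mathlib

/-!
# GridStability/Models/InverterDVOC — dispatchable virtual oscillator control (dVOC): printed reduced models

Cell `gridfusion` (LADDER-GRIDFUSION, rung G3 «inverter models», seat model-3), staged under
`HOME/lean/` until gate5 opens `lean/Summits/Ventures/GridStability/` (PARTITION §0).

THREE COLUMNS. Everything here is the MODELLED column: the dVOC reference dynamics of a
grid-forming converter, typed AS PRINTED with equation locators, in the two printed coordinate
systems. Nothing here asserts stability of a converter or grid; certificates about these vector
fields concern the MODEL; fidelity is a VALIDATED claim (plan/MODEL-VALIDITY.md, MV-INV-*).

WHY THIS FILE MATTERS FOR SOS (memo §3): in rectangular (αβ / dq) coordinates the dVOC vector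
field is a POLYNOMIAL of degree 3 in the voltage and current coordinates — no trigonometric
substitution and no algebraic constraint are needed, unlike droop / VSM / PLL models.

## Sources (read on the page this session)

* [cite: SuboticEtAl2021] I. Subotić, D. Groß, M. Colombino, F. Dörfler, IEEE TAC 66 (2021)
  5909–5924 (arXiv:1911.08945), §II notation (`R(θ) = [[cos θ, −sin θ], [sin θ, cos θ]]`), §VI-A
  «Dispatchable virtual oscillator control as reference model», the displayed reference dynamics
  `d/dt v̂ = η (K v̂ − R(κ) B i_t + η_a Φ(v̂) v̂)` with
  `K_k = (1/v_k*²) R(κ) [[p_k*, q_k*], [−q_k*, p_k*]]`, `Φ_k(v̂_k) = 1 − ‖v̂_k‖²/v_k*²`,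
  `κ = tan⁻¹(ω₀ ρ)` (uniform `ℓ/r` ratio `ρ`, Assumption 3), gains `η, η_a > 0`; and the
  quasi-steady-state network version `f^s_{v̂}(v̂) = η (K v̂ − R(κ) Y v̂ + η_a Φ(v̂) v̂)` of §VI-C.
* [cite: HenriquezAuba2022] R. Henriquez-Auba, PhD thesis UC Berkeley (UCB/EECS-2022-264, 2022),
  §2.5 eqs. (2.60a)–(2.60d): dVOC outer control in POLAR form (per unit, `Ω_b` base frequency):
  `θ̇ = Ω_b (ω_oc − ω_s)`,
  `v̇ = Ω_b [ (k₁/v) (−sin γ (p* − p_e) + cos γ (q* − q_e)) + k₂ ((v*)² − v²) v ]`,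
  `γ = ψ − π/2`, `ω_oc = ω_s + (k₁/v²) [cos γ (p* − p_e) + sin γ (q* − q_e)]` (`v = v_oc^{d,*}`).

## What is typed

§1 one converter's rectangular reference dynamics with the terminal current as input (verbatim
block of the printed stacked system) and the quasi-stationary closed form with a 2×2 real linear
current map; the voltage-regulation reading of `Φ`; §2 the polar form (2.60a)–(2.60d) verbatim.
The correspondence between the two printed parametrisations (`η, η_a, κ` vs `k₁, k₂, ψ`) is NOT
asserted here (different per-unit conventions; a MODEL-VALIDITY/PROVENANCE row if ever needed).

## Deliberately NOT here

The cascaded voltage/current reference-tracking loops of [cite: SuboticEtAl2021] §VI-B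
((eq. voltage/current PI controllers) — linear, they enlarge the state but keep polynomiality);
network/line dynamics; the original (non-dispatchable) Van der Pol virtual oscillator. No
parameter values (model-4 custody).
-/

noncomputable section

open Real

namespace Summit.Ventures.GridStability.Models.InverterDVOC

/-! ## §1 Rectangular dVOC reference dynamics (natively polynomial) -/

/-- Parameters of one converter's dVOC reference dynamics [cite: SuboticEtAl2021, §VI-A]: gains
`η, η_a`, rotation angle `κ = tan⁻¹(ω₀ ρ)`, set-points `p*, q*`, nominal voltage magnitude `v*`. -/
structure Dvoc where
  /-- synchronisation gain `η > 0` -/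
  η : ℝ
  /-- voltage-regulation gain `η_a > 0` -/
  ηa : ℝ
  /-- rotation angle `κ = tan⁻¹(ω₀ ρ)` of the uniform `ℓ/r` network -/
  κ : ℝ
  /-- active-power set-point `p*` -/
  pref : ℝ
  /-- reactive-power set-point `q*` -/
  qref : ℝ
  /-- nominal voltage magnitude `v* > 0` -/
  vref : ℝ

namespace Dvoc

variable (O : Dvoc)

/-- Normalised quadratic voltage error `Φ(v̂) = 1 − ‖v̂‖²/v*²` [cite: SuboticEtAl2021, §VI-A]
(«depending on the sign of `Φ` the voltage vector is scaled up or down»). Polynomial, degree 2. -/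
def phi (v₁ v₂ : ℝ) : ℝ := 1 - (v₁ ^ 2 + v₂ ^ 2) / O.vref ^ 2

/-- First component of `K v̂` with `K = (1/v*²) R(κ) [[p*, q*], [−q*, p*]]`,
`R(κ) = [[cos κ, −sin κ], [sin κ, cos κ]]` [cite: SuboticEtAl2021, §VI-A, §II]:
`(K v̂)₁ = (1/v*²) [cos κ (p* v₁ + q* v₂) − sin κ (−q* v₁ + p* v₂)]`. Linear in `v̂`. -/
def Kv₁ (v₁ v₂ : ℝ) : ℝ :=
  1 / O.vref ^ 2 * (cos O.κ * (O.pref * v₁ + O.qref * v₂) - sin O.κ * (-(O.qref * v₁) + O.pref * v₂))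

/-- Second component of `K v̂`:
`(K v̂)₂ = (1/v*²) [sin κ (p* v₁ + q* v₂) + cos κ (−q* v₁ + p* v₂)]`. -/
def Kv₂ (v₁ v₂ : ℝ) : ℝ :=
  1 / O.vref ^ 2 * (sin O.κ * (O.pref * v₁ + O.qref * v₂) + cos O.κ * (-(O.qref * v₁) + O.pref * v₂))

/-- First component of the reference dynamics with the terminal/output current `i = (i₁, i₂)` as
input [cite: SuboticEtAl2021, §VI-A displayed system, one converter block]:
`v̂̇₁ = η [ (K v̂)₁ − (cos κ i₁ − sin κ i₂) + η_a Φ(v̂) v̂₁ ]`. Polynomial of degree 3 in `(v̂, i)`. -/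
def dv₁ (v₁ v₂ i₁ i₂ : ℝ) : ℝ :=
  O.η * (O.Kv₁ v₁ v₂ - (cos O.κ * i₁ - sin O.κ * i₂) + O.ηa * O.phi v₁ v₂ * v₁)

/-- Second component: `v̂̇₂ = η [ (K v̂)₂ − (sin κ i₁ + cos κ i₂) + η_a Φ(v̂) v̂₂ ]`. -/
def dv₂ (v₁ v₂ i₁ i₂ : ℝ) : ℝ :=
  O.η * (O.Kv₂ v₁ v₂ - (sin O.κ * i₁ + cos O.κ * i₂) + O.ηa * O.phi v₁ v₂ * v₂)

/-- Quasi-stationary network closure `i = Y v̂` with a real 2×2 map `Y = [[y₁₁, y₁₂], [y₂₁, y₂₂]]`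
(for an `r–ℓ` branch to a stiff node, `Y` is the 2×2 real form of the complex admittance acting on
the voltage difference; kept abstract here), giving the printed reduced-order field
`f^s(v̂) = η (K v̂ − R(κ) Y v̂ + η_a Φ(v̂) v̂)` [cite: SuboticEtAl2021, §VI-C] — first component.
A cubic POLYNOMIAL vector field on `ℝ²` per converter: directly SOS-certifiable, no constraint. -/
def dv₁QS (y₁₁ y₁₂ y₂₁ y₂₂ : ℝ) (v₁ v₂ : ℝ) : ℝ :=
  O.dv₁ v₁ v₂ (y₁₁ * v₁ + y₁₂ * v₂) (y₂₁ * v₁ + y₂₂ * v₂)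

/-- Second component of the quasi-stationary reduced-order dVOC field `f^s(v̂)`. -/
def dv₂QS (y₁₁ y₁₂ y₂₁ y₂₂ : ℝ) (v₁ v₂ : ℝ) : ℝ :=
  O.dv₂ v₁ v₂ (y₁₁ * v₁ + y₁₂ * v₂) (y₂₁ * v₁ + y₂₂ * v₂)

/-- Voltage regulation reading: `Φ` vanishes exactly on the circle `‖v̂‖ = v*` (for `v* ≠ 0`). -/
theorem phi_eq_zero_iff (hv : O.vref ≠ 0) (v₁ v₂ : ℝ) :
    O.phi v₁ v₂ = 0 ↔ v₁ ^ 2 + v₂ ^ 2 = O.vref ^ 2 := by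
  unfold phi
  have h2 : O.vref ^ 2 ≠ 0 := pow_ne_zero 2 hv
  constructor
  · intro h
    field_simp at h
    linarith
  · intro h
    rw [h, div_self h2, sub_self]

/-- Rest point: at nominal magnitude (`Φ = 0`) with the current matching the set-point map,
`R(κ) i = K v̂`, the reference dynamics is stationary in the rotating frame («`d/dt v = 0` implies
that `v` rotates with the nominal frequency `ω₀`», [cite: SuboticEtAl2021, §VI-A]). -/
theorem rest_point {v₁ v₂ i₁ i₂ : ℝ} (hΦ : O.phi v₁ v₂ = 0)
    (h₁ : cos O.κ * i₁ - sin O.κ * i₂ = O.Kv₁ v₁ v₂)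
    (h₂ : sin O.κ * i₁ + cos O.κ * i₂ = O.Kv₂ v₁ v₂) :
    O.dv₁ v₁ v₂ i₁ i₂ = 0 ∧ O.dv₂ v₁ v₂ i₁ i₂ = 0 := by
  constructor
  · simp [dv₁, hΦ, h₁]
  · simp [dv₂, hΦ, h₂]

/-- The isolated oscillator (`i = 0`, `p* = q* = 0`) regulates the squared magnitude:
`d/dt ‖v̂‖² = 2 η η_a Φ(v̂) ‖v̂‖²` (pointwise identity of the fields; limit cycle `‖v̂‖ = v*`). -/
theorem magnitude_identity (hp : O.pref = 0) (hq : O.qref = 0) (v₁ v₂ : ℝ) :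
    2 * v₁ * O.dv₁ v₁ v₂ 0 0 + 2 * v₂ * O.dv₂ v₁ v₂ 0 0
      = 2 * O.η * O.ηa * O.phi v₁ v₂ * (v₁ ^ 2 + v₂ ^ 2) := by
  simp only [dv₁, dv₂, Kv₁, Kv₂, hp, hq]
  ring

end Dvoc

/-! ## §2 Polar dVOC outer control as printed (per unit) -/

/-- Parameters of the polar-form dVOC outer control [cite: HenriquezAuba2022, eqs. (2.60a)–(2.60d)]:
base frequency `Ω_b` [rad/s], grid SRF speed `ω_s` [pu], gains `k₁, k₂`, angle `ψ`
(`γ = ψ − π/2`), set-points `p*, q*, v*` [pu]. -/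
structure DvocPolar where
  /-- base angular frequency `Ω_b` [rad/s] -/
  Ωb : ℝ
  /-- angular speed `ω_s` of the grid reference frame [pu] -/
  ωs : ℝ
  /-- synchronisation gain `k₁` -/
  k₁ : ℝ
  /-- voltage-regulation gain `k₂` -/
  k₂ : ℝ
  /-- network angle `ψ` -/
  ψ : ℝ
  /-- active-power set-point `p*` -/
  pref : ℝ
  /-- reactive-power set-point `q*` -/
  qref : ℝ
  /-- voltage set-point `v*` -/
  vref : ℝ

namespace DvocPolar

variable (Q : DvocPolar)

/-- `γ = ψ − π/2` [cite: HenriquezAuba2022, eq. (2.60c)]. -/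
def gam : ℝ := Q.ψ - π / 2

/-- Frequency command `ω_oc = ω_s + (k₁/v²)[cos γ (p* − p_e) + sin γ (q* − q_e)]`
[cite: HenriquezAuba2022, eq. (2.60d)] (`v = v_oc^{d,*}`, the controlled voltage magnitude). -/
def omegaOc (pe qe v : ℝ) : ℝ :=
  Q.ωs + Q.k₁ / v ^ 2 * (cos Q.gam * (Q.pref - pe) + sin Q.gam * (Q.qref - qe))

/-- Angle equation `θ̇ = Ω_b (ω_oc − ω_s)` [cite: HenriquezAuba2022, eq. (2.60a)]. -/
def dθ (pe qe v : ℝ) : ℝ := Q.Ωb * (Q.omegaOc pe qe v - Q.ωs)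

/-- Voltage-magnitude equation [cite: HenriquezAuba2022, eq. (2.60b)]:
`v̇ = Ω_b [ (k₁/v)(−sin γ (p* − p_e) + cos γ (q* − q_e)) + k₂ ((v*)² − v²) v ]`.
RATIONAL in `v` (the `1/v` factor): polynomial after multiplication by `v > 0`, or use §1. -/
def dv (pe qe v : ℝ) : ℝ :=
  Q.Ωb * (Q.k₁ / v * (-(sin Q.gam) * (Q.pref - pe) + cos Q.gam * (Q.qref - qe))
    + Q.k₂ * (Q.vref ^ 2 - v ^ 2) * v)

/-- At the set-point (`p_e = p*`, `q_e = q*`, `v = v*`) the polar outer loop is at rest: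
`θ̇ = 0`, `v̇ = 0`. -/
theorem rest_at_setpoint : Q.dθ Q.pref Q.qref Q.vref = 0 ∧ Q.dv Q.pref Q.qref Q.vref = 0 := by
  constructor
  · simp [dθ, omegaOc]
  · simp [dv]

/-- Clearing the `1/v` denominator: for `v ≠ 0`,
`v · v̇ = Ω_b [ k₁ (−sin γ (p* − p_e) + cos γ (q* − q_e)) + k₂ ((v*)² − v²) v² ]`, a polynomial in
`(v, p_e, q_e)` — the form in which an SOS multiplier argument treats the polar model on `v > 0`. -/
theorem v_mul_dv (pe qe v : ℝ) (hv : v ≠ 0) :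
    v * Q.dv pe qe v
      = Q.Ωb * (Q.k₁ * (-(sin Q.gam) * (Q.pref - pe) + cos Q.gam * (Q.qref - qe))
          + Q.k₂ * (Q.vref ^ 2 - v ^ 2) * v ^ 2) := by
  unfold dv
  field_simp

end DvocPolar

end Summit.Ventures.GridStability.Models.InverterDVOC

end
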